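import Summits.HodgeConjecture.HodgeConjecture.Theorems.HLiu418FaltingsOfAlbCM
import Summits.HodgeConjecture.CorCM.HypLiu418.A3Liu418FaceTypes
import Literature.NumberTheory.Automorphic.Liu2021.AppendixC.EtaleFaltingsIsotypic
import HarnessLib

/-!
# The Faltings isotypic slot of the `hLiu418` cone WITHOUT [Faltings 1983]: from the `hF` binder at the faces, and from CM type of `Alb(X_K) ⊗ ℂ`

Summit `HodgeConjecture`, sub-problem `CorCM`, crux `HLiu418` (`Cruxes/HLiu418/Lines/a3_liu418.lean`), namespace
`Summit.HodgeConjecture.CorCM.Lines.A3Liu418`.  Cell `hodgecm-mathlib` (D-0151), line T5′ («CM-Albanese ∕ Mumford–Tate-torus road»,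
A-p09 (g12) 2026-08-29T15:21:27Z, A-plan1 (g12) 15:31:42Z, director s155; hands word A-p09 15:49:30Z (3)): the REGISTRY-SHAPED
junction (chain step (7), second half) between
* the crux's stub TYPE `StubFaltingsIsotypic` (`A3Liu418FaceTypes.lean`; closed in the registry through v21 by
  `Liu2021.AppendixC.faltingsIsotypic_of_isInducedBy` over the fact-level [Fal83] slot `stub_hypEllPowerTower`), and
* the binder `hF : ∀ K obj, faltings_tate_bijective (C.A K) (A_μ obj) ℓ` that `faltingsIsotypic_of_isInducedBy` actually consumes
  ([Liu2021, Thm. 4.18 proof l. 2245–2263] uses Faltings–Tate bijectivity ONLY at the pairs `(Alb(X_K), A_μ)`), respectively the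
  hypothesis «`Alb(X_K) ⊗ ℂ` is of CM type» from which A-p04's generic junction
  `Summit.HodgeConjecture.HodgeConjecture.Theorems.hF_of_isOfCMType_alb` (★ p730224; (N9) `faltings_tate_bijective_of_isOfCMType` =
  [Faltings1983, §5 Kor. 1] for CM pairs via [Shimura1998, Thm. 18.6] ★ `shimura1998_thm18_6_holds`, + `RestOne.isOfCMType_baseChange_aμOne`)
  produces that binder.

Contents (theorems only; no definition, no named fact, no instance, no `sorry`):
* §1 `stubFaltingsIsotypic_of_hF` — INSTANCE-FREE primary form: `StubFaltingsIsotypic` from the `hF` binder quantified over the face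
  prefix `(hDel, F, h6, ι₁, V, a, Φ, hΦ, ν, hν, hw, ℓ)` of `StubFaltingsIsotypic` at `(ℭ_V = CV hDel F V Φ, id, ι₁, CarN)`.  Registry v22 slot:
  `stub_faltingsIsotypic := stubFaltingsIsotypic_of_hF <T5′'s hF_T5prime_of_h413 h413>`.
* §2 `stubFaltingsIsotypic_of_exists_algebra_isOfCMType_A` — from «at every face and every small level there is SOME `ℂ`-algebra
  structure on `K_F` for which `Alb(X_K) ⊗_{K_F} ℂ` is of CM type» (instance chosen per face: at place ∕ off place `algebraAlong τ′`
  alike), via §1 and A-p04's junction; `stubFaltingsIsotypic_of_isOfCMType_A` — the same at the FIXED structure `ῑ₁ = conj ∘ ι₁`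
  (the convention of the cone's W4 file `A3Liu418AlbaneseCMType.isOfCMType_A_baseChange_CV`, the [MurtyRamakrishnan1992] fallback VI-1″).
CONDITIONAL on its hypotheses (and on `hDel` like the whole cone); this file proves nothing about [Faltings1983] in general, supplies
neither `hF` nor the CM-type statement, and changes no count.  HC_CM is proved only modulo the 7 printed citations until rung 0 closes.

## References
* [Liu2021] Y. Liu, *Fourier–Jacobi cycles and arithmetic relative trace formula*, Camb. J. Math. 9 (2021) (arXiv:2102.11518):
  Thm. 4.18 proof (FJcycle.tex l. 2245–2263); Def. 4.5 (2) (l. 1944–1950); Thm. 1.1 and Cor. (co:cm_albanese) (arXiv p. 4, pp. 22–23).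
* [Faltings1983] G. Faltings, *Endlichkeitssätze für abelsche Varietäten über Zahlkörpern*, Invent. Math. 73 (1983), §5 Satz 4, Korollar 1.
* [Shimura1998] G. Shimura, *Abelian Varieties with Complex Multiplication and Modular Functions* (1998), §18.6 Theorem 18.6.
* [MurtyRamakrishnan1992] V. K. Murty, D. Ramakrishnan, *The Albanese of unitary Shimura varieties*, in: The zeta functions of Picard
  modular surfaces (CRM, 1992), §2 Props. 1–2 (pp. 449–453) — the SHAPE of §2's hypothesis only; not formalised here.
-/

set_option autoImplicit false

noncomputable section

namespace Summit.HodgeConjecture.CorCM.Lines.A3Liu418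

open CategoryTheory NumberField
open Literature.NumberTheory.Automorphic
open HodgeCM.Model HodgeCM.Model.LiuIndex HodgeCM.Model.TowerCarrier
open Summit.HodgeConjecture.CorCM.Model
open Literature.AlgebraicGeometry.Motives (AbelianVariety CMType faltings_tate_bijective)
open Literature.AlgebraicGeometry.Milne1999 (IsOfCMType)
open Literature.AlgebraicGeometry.ShimuraVarieties.UnitaryCanonicalModel
open Literature.NumberTheory.Automorphic.Liu2021
open Literature.NumberTheory.Automorphic.Liu2021.AppendixC
open Literature.NumberTheory.Automorphic.Liu2021.AppendixC.RestOne (AμOne ObjOne)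
open Summit.HodgeConjecture.HodgeConjecture.Theorems (hF_of_isOfCMType_alb)

/-! ## §1 Instance-free: `StubFaltingsIsotypic` from the `hF` binder at the faces -/

set_option maxHeartbeats 400000 in -- measured (200 k, 400 k]: `StubFaltingsIsotypic`'s binder telescope (A-p03 g9, farm 2026-08-29)
/-- **The crux's Faltings slot from the `hF` binder at the faces (no [Faltings 1983] as typed, no `ℂ`-algebra instance)** — if for every
face datum `ℭ_V = CV hDel F V Φ` (`6 ≤ [F:ℚ]`, `ι₁ ∈ Φ`, any real scalar `a`), every conjugate-symplectic weight-one `ν`, every prime `ℓ`,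
every small level `K` and every object `D_ν ∈ 𝒜(ν)` the Tate map `ℤ_ℓ ⊗ Hom(Alb(X_K), A_ν) → Hom_{Γ}(T_ℓ Alb(X_K), T_ℓ A_ν)` is bijective
(the binder `hF` of `faltingsIsotypic_of_isInducedBy`, [Liu2021, Thm. 4.18 proof l. 2245–2263], at `(ℭ_V, id, ι₁, ν, CarN)`), then
`StubFaltingsIsotypic` holds — `faltingsIsotypic_of_isInducedBy` applied face by face.  Suppliers of `hF`: line T5′
(`H413 + HD3 + HD1″`, multiplicity-one lever, through `Theorems.hF_of_isOfCMType_alb`) or any CM-type statement for `Alb(X_K) ⊗ ℂ` (§2).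
[cite: Liu2021, Thm. 4.18 proof (FJcycle.tex l. 2245–2263)] [cite: Faltings1983Endlichkeit, §5 Korollar 1] [cite: SerreTate1968, §4 Thm. 5 (i)] -/
theorem stubFaltingsIsotypic_of_hF
    (hF : ∀ (hDel : canonicalModel_exists_printed) (F : HodgeCM.CMField) [IsGalois ℚ F] (h6 : 6 ≤ Module.finrank ℚ F) {ι₁ : F →+* ℂ}
      (V : HodgeCM.HermSpace3 F ι₁) (_a : RealScalar F) (Φ : CMType F) (_hΦ : ι₁ ∈ Φ.1)
      (ν : Literature.NumberTheory.Automorphic.IdeleClassGroup (F : Type) →ₜ* Circle)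
      (hν : IdeleClassGroup.IsConjugateSymplectic (F : Type) ν) (hw : IdeleClassGroup.HasWeight (F : Type) ν 1) (ℓ : ℕ) [Fact ℓ.Prime],
      ∀ (K : C5.SmallLevel (CV hDel F V Φ).S.K₀) (obj : ObjOne (AlgHom.id ℚ _) ι₁ hν hw (CarN F ι₁ ν hν)),
        faltings_tate_bijective ((CV hDel F V Φ).A K) (AμOne (AlgHom.id ℚ _) ι₁ hν hw (CarN F ι₁ ν hν) obj) ℓ) :
    StubFaltingsIsotypic :=
  fun hDel F _ h6 ι₁ V a Φ hΦ ν hν hw ℓ _ X ι' hX =>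
    faltingsIsotypic_of_isInducedBy (CV hDel F V Φ) (AlgHom.id ℚ _) ι₁ hν hw (CarN F ι₁ ν hν) ℓ ι' (TV hDel F h6 V Φ) X hX
      (hF hDel F h6 V a Φ hΦ ν hν hw ℓ)

/-! ## §2 From CM type of `Alb(X_K) ⊗ ℂ` (through A-p04's generic junction `Theorems.hF_of_isOfCMType_alb`) -/

set_option maxHeartbeats 400000 in -- measured (200 k, 400 k]: as §1
/-- **The crux's Faltings slot from CM type of `Alb(X_K) ⊗ ℂ` at SOME `ℂ`-algebra structure per face** — if at every face datum
`ℭ_V = CV hDel F V Φ` there is a `ℂ`-algebra structure on `K_F` (e.g. `algebraAlong τ′` of the pinning, at place `τ′ = conj ∘ ι₁` or off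
place) for which `Alb(X_K) ⊗_{K_F} ℂ` is of CM type at every small level `K`, then `StubFaltingsIsotypic` holds: §1 with
`hF := Theorems.hF_of_isOfCMType_alb` (instance-polymorphic; (N9) [Faltings1983, §5 Kor. 1] for CM pairs via [Shimura1998, Thm. 18.6] and
`A_ν ⊗ ℂ` of CM type by [Liu2021, Def. 4.5 (2)]).  The hypothesis is the conclusion shape of line T5′ ([Liu2021, Thm. 1.1 ∕ Cor.
(co:cm_albanese)]) and of VI-1″; it is NOT proved here.
[cite: Liu2021, Thm. 4.18 proof (FJcycle.tex l. 2245–2263); Def. 4.5 (2) (l. 1944–1950)] [cite: Faltings1983Endlichkeit, §5 Korollar 1]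
[cite: Shimura1998, §18.6 Theorem 18.6] -/
theorem stubFaltingsIsotypic_of_exists_algebra_isOfCMType_A
    (hAlb : ∀ (hDel : canonicalModel_exists_printed) (F : HodgeCM.CMField) [IsGalois ℚ F] (_h6 : 6 ≤ Module.finrank ℚ F) {ι₁ : F →+* ℂ}
      (V : HodgeCM.HermSpace3 F ι₁) (_a : RealScalar F) (Φ : CMType F) (_hΦ : ι₁ ∈ Φ.1),
      ∃ _ : Algebra ((⟨HodgeCM.CMField.K F⟩ : CMField) : Type) ℂ,
        ∀ K : C5.SmallLevel (CV hDel F V Φ).S.K₀, IsOfCMType (((CV hDel F V Φ).A K).baseChange ℂ)) :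
    StubFaltingsIsotypic :=
  stubFaltingsIsotypic_of_hF fun hDel F _ h6 ι₁ V a Φ hΦ ν hν hw ℓ _ => by
    obtain ⟨inst, halb⟩ := hAlb hDel F h6 V a Φ hΦ
    exact hF_of_isOfCMType_alb (CV hDel F V Φ) (AlgHom.id ℚ _) ι₁ hν hw (CarN F ι₁ ν hν) halb ℓ

set_option maxHeartbeats 400000 in -- measured (200 k, 400 k]: as §1
/-- **The crux's Faltings slot from CM type of `Alb(X_K) ⊗_{K_F, ῑ₁} ℂ`, `ῑ₁ = conj ∘ ι₁`** — the FIXED-instance form of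
`stubFaltingsIsotypic_of_exists_algebra_isOfCMType_A` at the `ℂ`-algebra structure `((starRingEnd ℂ).comp ι₁).toAlgebra` on `K_F`, the
convention of the cone's W4 statement `A3Liu418AlbaneseCMType.isOfCMType_A_baseChange_CV` ([MurtyRamakrishnan1992, §2]-shaped
hypothesis; VI-1″), which therefore plugs in by name.  Nothing about that hypothesis is proved here.
[cite: Liu2021, Thm. 4.18 proof (FJcycle.tex l. 2245–2263)] [cite: Faltings1983Endlichkeit, §5 Korollar 1] [cite: Shimura1998, §18.6 Theorem 18.6] -/
theorem stubFaltingsIsotypic_of_isOfCMType_A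
    (hAlb : ∀ (hDel : canonicalModel_exists_printed) (F : HodgeCM.CMField) [IsGalois ℚ F] (_h6 : 6 ≤ Module.finrank ℚ F) {ι₁ : F →+* ℂ}
      (V : HodgeCM.HermSpace3 F ι₁) (_a : RealScalar F) (Φ : CMType F) (_hΦ : ι₁ ∈ Φ.1),
      letI : Algebra ((⟨HodgeCM.CMField.K F⟩ : CMField) : Type) ℂ := ((starRingEnd ℂ).comp ι₁).toAlgebra
      ∀ K : C5.SmallLevel (CV hDel F V Φ).S.K₀, IsOfCMType (((CV hDel F V Φ).A K).baseChange ℂ)) :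
    StubFaltingsIsotypic :=
  stubFaltingsIsotypic_of_exists_algebra_isOfCMType_A fun hDel F _ h6 _ V a Φ hΦ => ⟨_, hAlb hDel F h6 V a Φ hΦ⟩

end Summit.HodgeConjecture.CorCM.Lines.A3Liu418

end
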